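import Literature.Computability.AlgebraicComplexity.BurgisserBooleanPartsA3Assembly

/-!
# LangWeilTransfer, support item `TameResolution` (stmt-ValiantsHypothesis-6378) — partial
# derivatives: coefficients through `optionEquivLeft`, flattening, weights and degrees

Route `LangWeilTransfer` of `ValiantsHypothesis` (conditional route; honest framing: bookkeeping,
nothing here bears on VP ≠ VNP). Quantitative pass (roadmap note of val-lit-p6 g9, §1(B)): the
numerators `V_j = -(∂_{Λ_j} q · B)(Λ := c)` of `exists_parametrisation_explicit` involve
`∂_{Λ_j} q = optionEquivLeft (pderiv (some j) (optionEquivLeft⁻¹ q))`; its `U`-coefficients are the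
`∂_{Λ_j}` of the coefficients of `q`, flattening `ℤ[T][Λ] ≅ ℤ[Λ ⊔ T]` carries `∂_{Λ_j}` to
`∂_{inl j}`, and a partial derivative does not increase the total degree and multiplies the weight
by at most the degree.

* `coeff_optionEquivLeft_pderiv_some` — `coeff_i (∂_{Λ_j} q) = ∂_{Λ_j} (coeff_i q)`;
* `sumAlgEquiv_symm_pderiv` — flattening commutes with `∂`;
* `totalDegree_pderiv_le`, `weight_pderiv_le` — sizes.
-/

noncomputable section

open MvPolynomial
open Literature.Computability.AlgebraicComplexity

-- the summit and the problem share the name `ValiantsHypothesis` (D-0017 single-conjunct layout)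
set_option linter.dupNamespace false

namespace Summit.ValiantsHypothesis.ValiantsHypothesis.Theorems.LangWeilTransfer

variable {R : Type*} [CommRing R] {σ : Type*}

/-- **Coefficients of `∂_{Λ_j}` through the dictionary `R[X_{Option σ}] ≅ R[X_σ][U]`:**
`coeff_i (optionEquivLeft (∂_{some j} f)) = ∂_j (coeff_i (optionEquivLeft f))`. -/
theorem coeff_optionEquivLeft_pderiv_some (f : MvPolynomial (Option σ) R) (j : σ) (i : ℕ) :
    (optionEquivLeft R σ (pderiv (some j) f)).coeff i = pderiv j ((optionEquivLeft R σ f).coeff i) := by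
  classical
  induction f using MvPolynomial.induction_on generalizing i with
  | C a =>
    rw [pderiv_C, map_zero, Polynomial.coeff_zero, optionEquivLeft_C, Polynomial.coeff_C]
    split_ifs
    · rw [pderiv_C]
    · rw [map_zero]
  | add p q hp hq => rw [map_add, map_add, Polynomial.coeff_add, hp, hq, map_add, Polynomial.coeff_add, map_add]
  | mul_X p v hp =>
    rw [pderiv_mul, map_add, map_mul, map_mul, Polynomial.coeff_add, map_mul]
    cases v with
    | none =>
      rw [optionEquivLeft_X_none, pderiv_X, Pi.single_eq_of_ne (by simp), map_zero, mul_zero,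
        Polynomial.coeff_zero, add_zero]
      cases i with
      | zero =>
        rw [Polynomial.mul_coeff_zero, Polynomial.mul_coeff_zero, Polynomial.coeff_X_zero, mul_zero, mul_zero,
          map_zero]
      | succ i => rw [Polynomial.coeff_mul_X, Polynomial.coeff_mul_X, hp]
    | some j' =>
      rw [optionEquivLeft_X_some, Polynomial.coeff_mul_C, Polynomial.coeff_mul_C, hp, pderiv_mul, pderiv_X,
        pderiv_X]
      by_cases hjj : j' = j
      · subst hjj
        rw [Pi.single_eq_same, Pi.single_eq_same, map_one, mul_one, mul_one]
      · rw [Pi.single_eq_of_ne (fun h => hjj (Option.some_injective _ h)), Pi.single_eq_of_ne hjj, map_zero,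
          mul_zero, mul_zero, Polynomial.coeff_zero]

/-- **Flattening commutes with partial derivatives in the outer variables.** -/
theorem sumAlgEquiv_symm_pderiv {S₁ S₂ : Type*} (g : MvPolynomial S₁ (MvPolynomial S₂ R)) (j : S₁) :
    (sumAlgEquiv R S₁ S₂).symm (pderiv j g) = pderiv (Sum.inl j) ((sumAlgEquiv R S₁ S₂).symm g) := by
  classical
  induction g using MvPolynomial.induction_on with
  | C a =>
    rw [pderiv_C, map_zero]
    -- `flat (C a) = rename inr a` has no `inl`-variables
    have hflat : (sumAlgEquiv R S₁ S₂).symm (C a) = rename Sum.inr a := by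
      have : ((sumAlgEquiv R S₁ S₂).symm.toAlgHom.comp
          (IsScalarTower.toAlgHom R (MvPolynomial S₂ R) (MvPolynomial S₁ (MvPolynomial S₂ R)))) = rename Sum.inr := by
        refine MvPolynomial.algHom_ext fun k => ?_
        simp only [AlgHom.comp_apply, IsScalarTower.toAlgHom_apply, MvPolynomial.algebraMap_eq,
          AlgEquiv.toAlgHom_apply, rename_X]
        exact sumAlgEquiv_symm_C_X (R := R) (S₁ := S₁) (c := k)
      have h := congrArg (fun φ => φ a) this
      simp only [AlgHom.comp_apply, IsScalarTower.toAlgHom_apply, MvPolynomial.algebraMap_eq,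
        AlgEquiv.toAlgHom_apply] at h
      exact h
    rw [hflat]
    symm
    refine pderiv_eq_zero_of_notMem_vars fun hmem => ?_
    obtain ⟨k, -, hk⟩ := mem_vars_rename _ _ hmem
    exact Sum.inl_ne_inr hk.symm
  | add p q hp hq => rw [map_add, map_add, hp, hq, map_add, map_add]
  | mul_X p j' hp =>
    rw [pderiv_mul, map_add, map_mul, map_mul, hp, map_mul, sumAlgEquiv_symm_X, pderiv_mul, pderiv_X, pderiv_X]
    by_cases hjj : j' = j
    · subst hjj
      rw [Pi.single_eq_same, Pi.single_eq_same, map_one]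
    · rw [Pi.single_eq_of_ne hjj, Pi.single_eq_of_ne (fun h => hjj (Sum.inl_injective h)), map_zero]

/-- **A partial derivative does not increase the total degree.** -/
theorem totalDegree_pderiv_le (f : MvPolynomial σ R) (v : σ) : (pderiv v f).totalDegree ≤ f.totalDegree := by
  classical
  conv_lhs => rw [f.as_sum]
  rw [map_sum]
  refine totalDegree_finsetSum_le fun m hm => ?_
  rw [pderiv_monomial]
  refine (totalDegree_monomial_le _ _).trans ?_
  refine le_trans ?_ (le_totalDegree hm)
  change Finsupp.degree (m - Finsupp.single v 1) ≤ Finsupp.degree m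
  exact Finsupp.degree_mono tsub_le_self


/-- **A partial derivative multiplies the weight by at most the degree in that variable.** -/
theorem weight_pderiv_le (f : MvPolynomial σ ℤ) (v : σ) : weight (pderiv v f) ≤ f.degreeOf v * weight f := by
  classical
  conv_lhs => rw [f.as_sum]
  rw [map_sum]
  refine (weight_finset_sum_le _ _).trans ?_
  have hwt : weight f = f.support.sum fun d => (f.coeff d).natAbs := rfl
  rw [hwt, Finset.mul_sum]
  refine Finset.sum_le_sum fun m hm => ?_
  rw [pderiv_monomial, weight_monomial, Int.natAbs_mul, Int.natAbs_natCast, mul_comm]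
  exact Nat.mul_le_mul_right _ (monomial_le_degreeOf v hm)

end Summit.ValiantsHypothesis.ValiantsHypothesis.Theorems.LangWeilTransfer
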